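import Summits.CriticalPhenomena.PercolationContinuityZ3.Theorems.Transplant.FKConnectivityAllQApexMass
import HarnessLib

/-!
# Connectivity correlation inequalities for `φ_{w,q}`, every `q > 0` — file 9c: apex elimination, THE PAIR CASES
# (an apex pair against anything; the base pair `g = uv` against a pair off the apex)

Support file (`--supports stmt-CriticalPhenomena-4575`), FK sub-lane `prim-bschramm-fk-1` (gen 5) of the post-continuity
programme; builds on p205010 (kernel theorem, internal audit signed; external expert review pending).  No definitions, no named
facts, no sorries; standard axioms.

THE ARGUMENT (files `…ApexTools`, `…ApexMass`, `…ApexCases`, `…ApexStep`, `…TwoTree`).  Wagner (Ann. Comb. 2008, Ex. 5.1 +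
Thm. 5.8(d) + §5.3) proves that the random-cluster (Potts) model with `0 < q ≤ 1` is Rayleigh — edge-negatively associated,
`φ(J_e ∩ J_f) ≤ φ(J_e)φ(J_f)` (Grimmett 2006 §3.9 (3.94)) — on every series–parallel graph, by induction over two-sums.  We prove the
graph case by APEX ELIMINATION over 2-trees (whose subgraphs are exactly the series–parallel = `K₄`-minor-free graphs): a 2-tree
is `{uv}` or `T ∪ {ux, xv}` with `uv ∈ T` and `x` fresh; for a weight vector `w` supported in `T ∪ {ux, xv}` write `a = ux`,
`b = xv`, `g = uv`, `w° = w[a↦0][b↦0]` and `K' = {u ↔ v avoiding a, b}`.  Three exact identities for events `F` insensitive to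
`a, b` (file `…ApexMass`): `S_w(F) = ((1−p_a)+p_a q⁻¹)((1−p_b)+p_b q⁻¹)·S°(F) − p_a p_b q⁻¹(q⁻¹−1)·S°(F ∩ K')`,
`S_w(J_b ∩ F ∩ K') = p_b q⁻¹·S°(F ∩ K')`, `S_w(J_a ∩ J_b ∩ F) = p_a p_b (q⁻¹ S°(F) + (q⁻¹−1)q⁻¹ S°(F ∩ K'ᶜ))`.  With fk-2's
master identity (`negCorr_defect_eq`: `Cov(J_e, J_f) ≤ 0 ⟺` opening `f` does not lower `φ_{w[e↦0]}(x ↔ y)`, `e = xy`) every pair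
reduces to EC⁺ for `u ↔ v` one level down, i.e. to negative association on `T` (file `…ApexCases`): `(a, f)`:
`φ_{w[a↦0][f↦s]}(u ↔ x) = θ·φ_{w°[f↦s]}(u ↔ v)`; `(g, f)`: `φ_{w[g↦0][f↦s]}(u ↔ v)` is an increasing Möbius function of
`φ_{w°[g↦0][f↦s]}(u ↔ v)`; `(a, b)`, `(a, g)`: unconditional; and pairs `e, f ⊆ T ∖ g` are MARGINALISED (file `…ApexStep`):
`S_w(E) = α·S_{w°[g↦c]}(E)` for `E ∈ {J_e ∩ J_f, J_e, J_f, Ω}` with `α = (1−p_a)(1−p_b) + (p_a+p_b−p_ap_b)q⁻¹` and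
`α c = α p_g + (1−p_g)p_a p_b q⁻¹` (the path `u–x–v` is a pair `uv` in parallel with `g`).

THIS FILE: EC⁺ for `u ↔ v` from negative association on the support (`edgeConnMono_of_negCorr_supp`, via fk-2's
`edgeConnMono_of_negCorr_at`), `edgeConnMono_self`; the cases `negCorr_apex_ab` (`a` vs `b`), `negCorr_apex_pair` (`a` vs
`f ∌ x`), `negCorr_base_pair` (`g` vs `f ∌ x`).
[cite: Wagner2006, Ex. 5.1, Thm. 5.8(d), §5.3] [cite: Grimmett2006, §3.9 eq. (3.94) (pp. 63–64); Thm. (3.1)(a) (p. 37)]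
[cite: AyyerLinussonRavichandran2025, §7 eq. (13)–(15) (p. 22)]
-/

noncomputable section

namespace Summit.CriticalPhenomena.PercolationContinuityZ3.Theorems

namespace FK

open MeasureTheory Set Literature.Probability.LatticeModels Literature.Probability.Percolation
open Literature.Probability.Percolation.DecisionTree (ind ind_of_mem ind_of_not_mem ind_nonneg)
open Literature.Probability.Percolation.TwoAvoidanceSets (ind_mul_ind)
open scoped Classical symmDiff

variable {V : Type*} [Fintype V]

/-! ### EC⁺ for the base pair `g = s(u,v)` from negative association on `T` -/

/-- **EC⁺ from negative association on the support** (`0 < q < 1`): if every weight vector supported in `T ∋ s(u,v)` is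
edge-negatively associated, then for `w` supported in `T` and `f ∈ T`, `f ≠ s(u,v)`, opening `f` does not lower `φ(u ↔ v)`.
[cite: Grimmett2006, §3.9 eq. (3.94) (p. 63); Thm. (3.1)(a) (p. 37)] -/
theorem edgeConnMono_of_negCorr_supp {q : ℝ} (hq0 : 0 < q) (hq1 : q < 1) {T : Set (Sym2 V)}
    (hNC : ∀ w' : Sym2 V → unitInterval, (∀ e, ((w' e : unitInterval) : ℝ) ≠ 0 → e ∈ T) → ∀ e f : Sym2 V, ¬ e.IsDiag → f ≠ e →
      (rcMeasureW w' q ∅).real ({ω | e ∈ ω} ∩ {ω | f ∈ ω}) ≤ (rcMeasureW w' q ∅).real {ω | e ∈ ω} * (rcMeasureW w' q ∅).real {ω | f ∈ ω})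
    {u v : V} (huvT : s(u, v) ∈ T) {f : Sym2 V} (hfT : f ∈ T)
    (w : Sym2 V → unitInterval) (hw : ∀ e, ((w e : unitInterval) : ℝ) ≠ 0 → e ∈ T) :
    (rcMeasureW (Function.update w f 0) q ∅).real (openConn u v) ≤
      (rcMeasureW (Function.update w f 1) q ∅).real (openConn u v) := by
  set half : unitInterval := ⟨2⁻¹, by norm_num, by norm_num⟩ with hhalf
  refine edgeConnMono_of_negCorr_at hq0 hq1 w f u v half (by norm_num [hhalf]) (by norm_num [hhalf]) fun huv hfe => ?_
  refine hNC _ (supp_update_mem (supp_update_mem hw huvT half) hfT half) s(u, v) f ?_ hfe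
  rw [Sym2.mk_isDiag_iff]; exact huv

/-- Contracting `g = s(u,v)` makes `u ↔ v` almost sure, so `φ_{w[g↦0]}(u ↔ v) ≤ φ_{w[g↦1]}(u ↔ v) = 1`.
[cite: Grimmett2006, §1.4 eq. (1.20) (p. 15)] -/
theorem edgeConnMono_self {q : ℝ} (hq0 : 0 < q) (w : Sym2 V → unitInterval) (u v : V) :
    (rcMeasureW (Function.update w s(u, v) 0) q ∅).real (openConn u v) ≤
      (rcMeasureW (Function.update w s(u, v) 1) q ∅).real (openConn u v) := by
  have h1 : (rcMeasureW (Function.update w s(u, v) 1) q ∅).real (openConn u v) = 1 := by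
    rw [rcMeasureW_real_eq_sum_div _ hq0 ∅, sum_rcWeightW_ind_eq_Z_ae _ q,
      div_self (rcPartitionFunctionW_pos _ hq0 (∅ : Set V)).ne']
    intro ω hω
    have hg : s(u, v) ∈ ω := mem_of_rcWeightW_ne_zero _ q (by simp) hω
    rw [mem_openConn_iff']
    by_cases huv : u = v
    · subst huv; exact SimpleGraph.Reachable.refl u
    · have hadj : (openGraph ω).Adj u v := by rw [openGraph_adj]; exact ⟨hg, huv⟩
      exact hadj.reachable
  rw [h1, rcMeasureW_real_eq_sum_div _ hq0 ∅]
  exact (div_le_one (rcPartitionFunctionW_pos _ hq0 (∅ : Set V))).2 (sum_rcWeightW_ind_le_Z _ hq0.le _)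

/-! ### Case (b): the two apex pairs -/

/-- **The two apex pairs are negatively associated**: with both apex pairs closed `x` is isolated, so `φ_{w[a↦0][b↦0]}(u ↔ x) = 0`
and the local criterion applies. [cite: Grimmett2006, §3.9 eq. (3.94) (p. 63); Thm. (3.1)(a) (p. 37)] -/
theorem negCorr_apex_ab {q : ℝ} (hq0 : 0 < q) (hq1 : q ≤ 1) (w : Sym2 V → unitInterval) {u v x : V} (hxu : x ≠ u)
    (hxv : x ≠ v) (huv : u ≠ v) (hw : ∀ e : Sym2 V, x ∈ e → ((w e : unitInterval) : ℝ) ≠ 0 → u ∈ e ∨ v ∈ e) :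
    (rcMeasureW w q ∅).real ({ω | s(u, x) ∈ ω} ∩ {ω | s(x, v) ∈ ω}) ≤
      (rcMeasureW w q ∅).real {ω | s(u, x) ∈ ω} * (rcMeasureW w q ∅).real {ω | s(x, v) ∈ ω} := by
  have hab := apex_pairs_ne hxu huv
  refine negCorr_of_edgeConnMono_at hq0 hq1 w hab.symm ?_
  have hw0 := apex_hyp_update hw s(u, x) (fun _ => Or.inl (Sym2.mem_mk_left u x)) 0
  have hw00 := apex_hyp_update hw0 s(x, v) (fun _ => Or.inr (Sym2.mem_mk_right x v)) 0
  have ha : ((Function.update (Function.update w s(u, x) 0) s(x, v) 0 s(u, x) : unitInterval) : ℝ) = 0 := by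
    rw [Function.update_of_ne hab]; simp
  have hb : ((Function.update (Function.update w s(u, x) 0) s(x, v) 0 s(x, v) : unitInterval) : ℝ) = 0 := by simp
  have h0 : (rcMeasureW (Function.update (Function.update w s(u, x) 0) s(x, v) 0) q ∅).real (openConn u x) = 0 := by
    rw [rcMeasureW_real_eq_sum_div _ hq0 ∅, sum_rcWeightW_ind_eq_zero_ae _ q, zero_div]
    intro ω hω
    have hiso := isolated_of_rcWeightW_ne_zero _ q hxu hxv hw00 ha hb hω
    exact not_reachable_of_isolated' hiso hxu.symm
  rw [h0]
  exact measureReal_nonneg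


/-! ### Case (a/g): an apex pair against a pair off `x` -/

/-- **An apex pair `a = s(u,x)` is negatively associated with every pair `f` off `x`**, provided opening `f` does not lower
`φ°(u ↔ v)` in the apex-deleted state `w° = w[a↦0][b↦0]` (which is EC⁺ one level down).  Mechanism: with `a` closed,
`u ↔ x` iff `b` is open and `u ↔ v` avoiding `x`, and `b` is then a pendant pair: `φ_{w[a↦0][f↦s]}(u ↔ x) = θ·φ_{w°[f↦s]}(u ↔ v)`
with `θ = (w b)q⁻¹/((1 − w b) + (w b)q⁻¹)` independent of `s`. [cite: Grimmett2006, §3.9 eq. (3.94) (p. 63); Thm. (3.1)(a) (p. 37)] -/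
theorem negCorr_apex_pair {q : ℝ} (hq0 : 0 < q) (hq1 : q ≤ 1) (w : Sym2 V → unitInterval) {u v x : V} (hxu : x ≠ u)
    (hxv : x ≠ v) (huv : u ≠ v) (hw : ∀ e : Sym2 V, x ∈ e → ((w e : unitInterval) : ℝ) ≠ 0 → u ∈ e ∨ v ∈ e)
    {f : Sym2 V} (hfx : x ∉ f)
    (hEC : (rcMeasureW (Function.update (Function.update (Function.update w s(u, x) 0) s(x, v) 0) f 0) q ∅).real (openConn u v) ≤
      (rcMeasureW (Function.update (Function.update (Function.update w s(u, x) 0) s(x, v) 0) f 1) q ∅).real (openConn u v)) :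
    (rcMeasureW w q ∅).real ({ω | s(u, x) ∈ ω} ∩ {ω | f ∈ ω}) ≤
      (rcMeasureW w q ∅).real {ω | s(u, x) ∈ ω} * (rcMeasureW w q ∅).real {ω | f ∈ ω} := by
  have hab := apex_pairs_ne hxu huv
  have hfa : f ≠ s(u, x) := fun h => hfx (h ▸ Sym2.mem_mk_right u x)
  have hfb : f ≠ s(x, v) := fun h => hfx (h ▸ Sym2.mem_mk_left x v)
  set K : Set (BondConfig V) := {ω : BondConfig V | ω \ {s(u, x), s(x, v)} ∈ (openConn u v : Set (BondConfig V))} with hK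
  have hKb : ∀ ω : BondConfig V, ω ∆ {s(x, v)} ∈ K ↔ ω ∈ K := apexAvoid_insens u v x (Or.inr rfl)
  have huniv : ∀ ω : BondConfig V, ω ∆ {s(x, v)} ∈ (Set.univ : Set (BondConfig V)) ↔ ω ∈ (Set.univ : Set (BondConfig V)) :=
    fun ω => by simp
  refine negCorr_of_edgeConnMono_at hq0 hq1 w hfa ?_
  rw [real_le_real_iff_mass hq0]
  rw [real_le_real_iff_mass hq0] at hEC
  -- the two states `A_s = w[a↦0][f↦s]`
  have key : ∀ s : unitInterval,
      (∑ ω : BondConfig V, rcWeightW (Function.update (Function.update w s(u, x) 0) f s) q ∅ ω *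
          ind (openConn u x : Set (BondConfig V)) ω =
        ((w s(x, v) : unitInterval) : ℝ) * q⁻¹ *
          ∑ ω : BondConfig V, rcWeightW (Function.update (Function.update (Function.update w s(u, x) 0) s(x, v) 0) f s) q ∅ ω *
            ind (openConn u v : Set (BondConfig V)) ω) ∧
      rcPartitionFunctionW (Function.update (Function.update w s(u, x) 0) f s) q ∅ =
        ((1 - ((w s(x, v) : unitInterval) : ℝ)) + ((w s(x, v) : unitInterval) : ℝ) * q⁻¹) *
          rcPartitionFunctionW (Function.update (Function.update (Function.update w s(u, x) 0) s(x, v) 0) f s) q ∅ := by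
    intro s
    have hwA := apex_hyp_update (apex_hyp_update hw s(u, x) (fun _ => Or.inl (Sym2.mem_mk_left u x)) 0) f
      (fun h => absurd h hfx) s
    have haA : ((Function.update (Function.update w s(u, x) 0) f s s(u, x) : unitInterval) : ℝ) = 0 := by
      rw [Function.update_of_ne hfa.symm]; simp
    have hbA : ((Function.update (Function.update w s(u, x) 0) f s s(x, v) : unitInterval) : ℝ) =
        ((w s(x, v) : unitInterval) : ℝ) := by
      rw [Function.update_of_ne hfb.symm, Function.update_of_ne hab.symm]
    -- the state with `b` also killed is `w°[f↦s]`
    have hcomm : Function.update (Function.update (Function.update w s(u, x) 0) f s) s(x, v) 0 =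
        Function.update (Function.update (Function.update w s(u, x) 0) s(x, v) 0) f s :=
      Function.update_comm hfb _ _ _
    have hw0s := apex_hyp_update hwA s(x, v) (fun _ => Or.inr (Sym2.mem_mk_right x v)) 0
    have ha0s : ((Function.update (Function.update (Function.update w s(u, x) 0) f s) s(x, v) 0 s(u, x) : unitInterval) : ℝ) =
        0 := by rw [Function.update_of_ne hab]; exact haA
    have hb0s : ((Function.update (Function.update (Function.update w s(u, x) 0) f s) s(x, v) 0 s(x, v) : unitInterval) : ℝ) =
        0 := by simp
    constructor
    · -- `u ↔ x` a.s. iff `b` open and `K`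
      have h1 : ∑ ω : BondConfig V, rcWeightW (Function.update (Function.update w s(u, x) 0) f s) q ∅ ω *
          ind (openConn u x : Set (BondConfig V)) ω =
          ∑ ω : BondConfig V, rcWeightW (Function.update (Function.update w s(u, x) 0) f s) q ∅ ω *
            ind ({ω | s(x, v) ∈ ω} ∩ K) ω := by
        refine sum_rcWeightW_ind_congr_ae _ q fun ω hω => ?_
        have hapex := apex_of_rcWeightW_ne_zero _ q hxu hxv hwA hω
        have ha : s(u, x) ∉ ω := not_mem_of_rcWeightW_ne_zero _ q haA hω
        rw [mem_openConn_iff', reachable_ux_apex_iff hxu hxv hapex]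
        simp only [ha, false_or, Set.mem_inter_iff, Set.mem_setOf_eq, hK]
        exact Iff.rfl
      -- under `w°[f↦s]`, `K` a.s. iff `u ↔ v`
      have h2 : ∑ ω : BondConfig V, rcWeightW (Function.update (Function.update (Function.update w s(u, x) 0) f s) s(x, v) 0)
          q ∅ ω * ind K ω =
          ∑ ω : BondConfig V, rcWeightW (Function.update (Function.update (Function.update w s(u, x) 0) f s) s(x, v) 0)
            q ∅ ω * ind (openConn u v : Set (BondConfig V)) ω := by
        refine sum_rcWeightW_ind_congr_ae _ q fun ω hω => ?_
        have hapex := apex_of_rcWeightW_ne_zero _ q hxu hxv hw0s hω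
        have ha : s(u, x) ∉ ω := not_mem_of_rcWeightW_ne_zero _ q ha0s hω
        rw [hK, Set.mem_setOf_eq, mem_openConn_iff', mem_openConn_iff', reachable_uv_apex_iff hxu hxv hapex]
        simp only [ha, false_and, or_false]
      rw [h1, sum_pendant_openPair _ hq0.ne' hxu hxv huv hwA haA K hKb, hbA, h2, hcomm]
    · rw [← sum_rcWeightW_ind_univ, sum_pendant_affine _ hq0.ne' hxu hxv huv hwA haA Set.univ huniv, hbA,
        sum_rcWeightW_ind_univ, hcomm]
  obtain ⟨k0, z0⟩ := key 0
  obtain ⟨k1, z1⟩ := key 1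
  rw [k0, z0, k1, z1]
  have hp0 : 0 ≤ ((w s(x, v) : unitInterval) : ℝ) := (w s(x, v)).2.1
  have hp1 : ((w s(x, v) : unitInterval) : ℝ) ≤ 1 := (w s(x, v)).2.2
  have hqi : 0 ≤ q⁻¹ := inv_nonneg.2 hq0.le
  have hc : 0 ≤ ((w s(x, v) : unitInterval) : ℝ) * q⁻¹ * ((1 - ((w s(x, v) : unitInterval) : ℝ)) + ((w s(x, v) : unitInterval) : ℝ) * q⁻¹) := by
    have : 0 ≤ 1 - ((w s(x, v) : unitInterval) : ℝ) := by linarith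
    positivity
  calc ((w s(x, v) : unitInterval) : ℝ) * q⁻¹ *
          (∑ ω : BondConfig V, rcWeightW (Function.update (Function.update (Function.update w s(u, x) 0) s(x, v) 0) f 0) q ∅ ω *
            ind (openConn u v : Set (BondConfig V)) ω) *
        (((1 - ((w s(x, v) : unitInterval) : ℝ)) + ((w s(x, v) : unitInterval) : ℝ) * q⁻¹) *
          rcPartitionFunctionW (Function.update (Function.update (Function.update w s(u, x) 0) s(x, v) 0) f 1) q ∅)
      = ((w s(x, v) : unitInterval) : ℝ) * q⁻¹ * ((1 - ((w s(x, v) : unitInterval) : ℝ)) + ((w s(x, v) : unitInterval) : ℝ) * q⁻¹) *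
          ((∑ ω : BondConfig V, rcWeightW (Function.update (Function.update (Function.update w s(u, x) 0) s(x, v) 0) f 0) q ∅ ω *
              ind (openConn u v : Set (BondConfig V)) ω) *
            rcPartitionFunctionW (Function.update (Function.update (Function.update w s(u, x) 0) s(x, v) 0) f 1) q ∅) := by
        ring
    _ ≤ ((w s(x, v) : unitInterval) : ℝ) * q⁻¹ * ((1 - ((w s(x, v) : unitInterval) : ℝ)) + ((w s(x, v) : unitInterval) : ℝ) * q⁻¹) *
          ((∑ ω : BondConfig V, rcWeightW (Function.update (Function.update (Function.update w s(u, x) 0) s(x, v) 0) f 1) q ∅ ω *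
              ind (openConn u v : Set (BondConfig V)) ω) *
            rcPartitionFunctionW (Function.update (Function.update (Function.update w s(u, x) 0) s(x, v) 0) f 0) q ∅) :=
        mul_le_mul_of_nonneg_left hEC hc
    _ = _ := by ring


/-! ### Case (d): the base pair `g = s(u,v)` against a pair off `x` -/

/-- **The base pair `g = s(u,v)` is negatively associated with every pair `f ∌ x`, `f ≠ g`**, provided opening `f` does not
lower `φ(u ↔ v)` in the state `w°[g↦0]` (apex pairs and `g` deleted — EC⁺ one level down).  Mechanism: with `g` closed,
`u ↔ v` iff `u ↔ v` avoiding `x` or both apex pairs are open; by the apex identities `φ_{w[g↦0][f↦s]}(u ↔ v) = h(φ_{w°[g↦0][f↦s]}(u ↔ v))`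
for one increasing Möbius map `h` independent of `s`. [cite: Grimmett2006, §3.9 eq. (3.94) (p. 63); Thm. (3.1)(a) (p. 37)] -/
theorem negCorr_base_pair {q : ℝ} (hq0 : 0 < q) (hq1 : q ≤ 1) (w : Sym2 V → unitInterval) {u v x : V} (hxu : x ≠ u)
    (hxv : x ≠ v) (huv : u ≠ v) (hw : ∀ e : Sym2 V, x ∈ e → ((w e : unitInterval) : ℝ) ≠ 0 → u ∈ e ∨ v ∈ e)
    {f : Sym2 V} (hfx : x ∉ f) (hfg : f ≠ s(u, v))
    (hEC : (rcMeasureW (Function.update (Function.update (Function.update (Function.update w s(u, x) 0) s(x, v) 0) s(u, v) 0) f 0)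
        q ∅).real (openConn u v) ≤
      (rcMeasureW (Function.update (Function.update (Function.update (Function.update w s(u, x) 0) s(x, v) 0) s(u, v) 0) f 1)
        q ∅).real (openConn u v)) :
    (rcMeasureW w q ∅).real ({ω | s(u, v) ∈ ω} ∩ {ω | f ∈ ω}) ≤
      (rcMeasureW w q ∅).real {ω | s(u, v) ∈ ω} * (rcMeasureW w q ∅).real {ω | f ∈ ω} := by
  have hab := apex_pairs_ne hxu huv
  have hfa : f ≠ s(u, x) := fun h => hfx (h ▸ Sym2.mem_mk_right u x)
  have hfb : f ≠ s(x, v) := fun h => hfx (h ▸ Sym2.mem_mk_left x v)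
  have hgx : x ∉ s(u, v) := by
    rw [Sym2.mem_iff]; rintro (h | h); exacts [hxu h, hxv h]
  have hga : s(u, v) ≠ s(u, x) := fun h => hgx (h ▸ Sym2.mem_mk_right u x)
  have hgb : s(u, v) ≠ s(x, v) := fun h => hgx (h ▸ Sym2.mem_mk_left x v)
  set K : Set (BondConfig V) := {ω : BondConfig V | ω \ {s(u, x), s(x, v)} ∈ (openConn u v : Set (BondConfig V))} with hK
  have hKa : ∀ ω : BondConfig V, ω ∆ {s(u, x)} ∈ K ↔ ω ∈ K := apexAvoid_insens u v x (Or.inl rfl)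
  have hKb : ∀ ω : BondConfig V, ω ∆ {s(x, v)} ∈ K ↔ ω ∈ K := apexAvoid_insens u v x (Or.inr rfl)
  have hKca : ∀ ω : BondConfig V, ω ∆ {s(u, x)} ∈ Kᶜ ↔ ω ∈ Kᶜ := apexAvoid_compl_insens u v x (Or.inl rfl)
  have hKcb : ∀ ω : BondConfig V, ω ∆ {s(x, v)} ∈ Kᶜ ↔ ω ∈ Kᶜ := apexAvoid_compl_insens u v x (Or.inr rfl)
  have hUa : ∀ ω : BondConfig V, ω ∆ {s(u, x)} ∈ (Set.univ : Set (BondConfig V)) ↔ ω ∈ (Set.univ : Set (BondConfig V)) :=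
    fun ω => by simp
  have hUb : ∀ ω : BondConfig V, ω ∆ {s(x, v)} ∈ (Set.univ : Set (BondConfig V)) ↔ ω ∈ (Set.univ : Set (BondConfig V)) :=
    fun ω => by simp
  refine negCorr_of_edgeConnMono_at hq0 hq1 w hfg ?_
  rw [real_le_real_iff_mass hq0]
  rw [real_le_real_iff_mass hq0] at hEC
  -- the two states `C_s = w[g↦0][f↦s]` and their apex-deleted versions `D_s = w°[g↦0][f↦s]`
  have key : ∀ s : unitInterval,
      (∑ ω : BondConfig V, rcWeightW (Function.update (Function.update w s(u, v) 0) f s) q ∅ ω *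
          ind (openConn u v : Set (BondConfig V)) ω =
        (((1 - ((w s(u, x) : unitInterval) : ℝ)) + ((w s(u, x) : unitInterval) : ℝ) * q⁻¹) *
              ((1 - ((w s(x, v) : unitInterval) : ℝ)) + ((w s(x, v) : unitInterval) : ℝ) * q⁻¹) -
            ((w s(u, x) : unitInterval) : ℝ) * ((w s(x, v) : unitInterval) : ℝ) * q⁻¹ * (q⁻¹ - 1)) *
          (∑ ω : BondConfig V, rcWeightW (Function.update (Function.update (Function.update (Function.update w s(u, x) 0)
            s(x, v) 0) s(u, v) 0) f s) q ∅ ω * ind (openConn u v : Set (BondConfig V)) ω) +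
        ((w s(u, x) : unitInterval) : ℝ) * ((w s(x, v) : unitInterval) : ℝ) * (q⁻¹ * q⁻¹) *
          (rcPartitionFunctionW (Function.update (Function.update (Function.update (Function.update w s(u, x) 0)
            s(x, v) 0) s(u, v) 0) f s) q ∅ -
           ∑ ω : BondConfig V, rcWeightW (Function.update (Function.update (Function.update (Function.update w s(u, x) 0)
            s(x, v) 0) s(u, v) 0) f s) q ∅ ω * ind (openConn u v : Set (BondConfig V)) ω)) ∧
      rcPartitionFunctionW (Function.update (Function.update w s(u, v) 0) f s) q ∅ =
        (((1 - ((w s(u, x) : unitInterval) : ℝ)) + ((w s(u, x) : unitInterval) : ℝ) * q⁻¹) *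
              ((1 - ((w s(x, v) : unitInterval) : ℝ)) + ((w s(x, v) : unitInterval) : ℝ) * q⁻¹)) *
          rcPartitionFunctionW (Function.update (Function.update (Function.update (Function.update w s(u, x) 0)
            s(x, v) 0) s(u, v) 0) f s) q ∅ -
        ((w s(u, x) : unitInterval) : ℝ) * ((w s(x, v) : unitInterval) : ℝ) * q⁻¹ * (q⁻¹ - 1) *
          ∑ ω : BondConfig V, rcWeightW (Function.update (Function.update (Function.update (Function.update w s(u, x) 0)
            s(x, v) 0) s(u, v) 0) f s) q ∅ ω * ind (openConn u v : Set (BondConfig V)) ω := by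
    intro s
    -- the state `C_s`
    have hwC := apex_hyp_update (apex_hyp_update hw s(u, v) (fun h => absurd h hgx) 0) f (fun h => absurd h hfx) s
    have haC : ((Function.update (Function.update w s(u, v) 0) f s s(u, x) : unitInterval) : ℝ) =
        ((w s(u, x) : unitInterval) : ℝ) := by
      rw [Function.update_of_ne hfa.symm, Function.update_of_ne hga.symm]
    have hbC : ((Function.update (Function.update w s(u, v) 0) f s s(x, v) : unitInterval) : ℝ) =
        ((w s(x, v) : unitInterval) : ℝ) := by
      rw [Function.update_of_ne hfb.symm, Function.update_of_ne hgb.symm]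
    -- its apex-deleted version is `D_s`
    have hcomm : Function.update (Function.update (Function.update (Function.update w s(u, v) 0) f s) s(u, x) 0) s(x, v) 0 =
        Function.update (Function.update (Function.update (Function.update w s(u, x) 0) s(x, v) 0) s(u, v) 0) f s := by
      rw [Function.update_comm hfa, Function.update_comm hga, Function.update_comm hfb, Function.update_comm hgb]
    have hwD : ∀ e : Sym2 V, x ∈ e →
        ((Function.update (Function.update (Function.update (Function.update w s(u, v) 0) f s) s(u, x) 0) s(x, v) 0 e :
          unitInterval) : ℝ) ≠ 0 → u ∈ e ∨ v ∈ e :=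
      apex_hyp_update (apex_hyp_update hwC s(u, x) (fun _ => Or.inl (Sym2.mem_mk_left u x)) 0) s(x, v)
        (fun _ => Or.inr (Sym2.mem_mk_right x v)) 0
    have haD : ((Function.update (Function.update (Function.update (Function.update w s(u, v) 0) f s) s(u, x) 0) s(x, v) 0
        s(u, x) : unitInterval) : ℝ) = 0 := by rw [Function.update_of_ne hab]; simp
    have hbD : ((Function.update (Function.update (Function.update (Function.update w s(u, v) 0) f s) s(u, x) 0) s(x, v) 0
        s(x, v) : unitInterval) : ℝ) = 0 := by simp
    -- under `D_s`, `K` a.s. iff `u ↔ v`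
    have hKD : ∑ ω : BondConfig V, rcWeightW (Function.update (Function.update (Function.update (Function.update w s(u, v) 0)
        f s) s(u, x) 0) s(x, v) 0) q ∅ ω * ind K ω =
        ∑ ω : BondConfig V, rcWeightW (Function.update (Function.update (Function.update (Function.update w s(u, v) 0)
          f s) s(u, x) 0) s(x, v) 0) q ∅ ω * ind (openConn u v : Set (BondConfig V)) ω := by
      refine sum_rcWeightW_ind_congr_ae _ q fun ω hω => ?_
      have hapex := apex_of_rcWeightW_ne_zero _ q hxu hxv hwD hω
      have ha : s(u, x) ∉ ω := not_mem_of_rcWeightW_ne_zero _ q haD hω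
      rw [hK, Set.mem_setOf_eq, mem_openConn_iff', mem_openConn_iff', reachable_uv_apex_iff hxu hxv hapex]
      simp only [ha, false_and, or_false]
    rw [hcomm] at hKD
    -- split `u ↔ v` along `K`
    have hsplit := sum_rcWeightW_ind_inter_compl (Function.update (Function.update w s(u, v) 0) f s) q
      (openConn u v : Set (BondConfig V)) K
    have hinK : ∑ ω : BondConfig V, rcWeightW (Function.update (Function.update w s(u, v) 0) f s) q ∅ ω *
        ind ((openConn u v : Set (BondConfig V)) ∩ K) ω =
        ∑ ω : BondConfig V, rcWeightW (Function.update (Function.update w s(u, v) 0) f s) q ∅ ω * ind K ω := by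
      refine sum_rcWeightW_ind_congr_ae _ q fun ω hω => ?_
      have hapex := apex_of_rcWeightW_ne_zero _ q hxu hxv hwC hω
      rw [Set.mem_inter_iff, mem_openConn_iff', reachable_uv_apex_iff hxu hxv hapex, hK, Set.mem_setOf_eq, mem_openConn_iff']
      constructor
      · exact fun h => h.2
      · exact fun h => ⟨Or.inl h, h⟩
    have hoffK : ∑ ω : BondConfig V, rcWeightW (Function.update (Function.update w s(u, v) 0) f s) q ∅ ω *
        ind ((openConn u v : Set (BondConfig V)) ∩ Kᶜ) ω =
        ∑ ω : BondConfig V, rcWeightW (Function.update (Function.update w s(u, v) 0) f s) q ∅ ω *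
          ind ({ω | s(u, x) ∈ ω} ∩ ({ω | s(x, v) ∈ ω} ∩ Kᶜ)) ω := by
      refine sum_rcWeightW_ind_congr_ae _ q fun ω hω => ?_
      have hapex := apex_of_rcWeightW_ne_zero _ q hxu hxv hwC hω
      rw [Set.mem_inter_iff, mem_openConn_iff', reachable_uv_apex_iff hxu hxv hapex, Set.mem_inter_iff, Set.mem_inter_iff,
        Set.mem_compl_iff, hK, Set.mem_setOf_eq, mem_openConn_iff', Set.mem_setOf_eq, Set.mem_setOf_eq]
      tauto
    -- the apex identities in the state `C_s`
    have hA1 := apex_mass (Function.update (Function.update w s(u, v) 0) f s) hq0.ne' hxu hxv huv hwC K hKa hKb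
    have hA3 := apex_mass_ab_inter (Function.update (Function.update w s(u, v) 0) f s) hq0.ne' hxu hxv huv hwC Kᶜ hKca hKcb
    have hAZ := apex_mass (Function.update (Function.update w s(u, v) 0) f s) hq0.ne' hxu hxv huv hwC Set.univ hUa hUb
    rw [haC, hbC, hcomm] at hA1 hA3 hAZ
    rw [Set.inter_self] at hA1
    rw [← Set.compl_union, Set.union_self, sum_rcWeightW_ind_compl, hKD] at hA3
    rw [Set.univ_inter, sum_rcWeightW_ind_univ, sum_rcWeightW_ind_univ, hKD] at hAZ
    rw [hKD] at hA1
    constructor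
    · have h := hsplit
      rw [hinK, hoffK, hA1, hA3] at h
      linarith [h]
    · exact hAZ
  obtain ⟨k0, z0⟩ := key 0
  obtain ⟨k1, z1⟩ := key 1
  rw [k0, z0, k1, z1]
  -- positivity bookkeeping
  set p₁ : ℝ := ((w s(u, x) : unitInterval) : ℝ) with hp₁
  set p₂ : ℝ := ((w s(x, v) : unitInterval) : ℝ) with hp₂
  set r : ℝ := q⁻¹ with hr
  set S0 := ∑ ω : BondConfig V, rcWeightW (Function.update (Function.update (Function.update (Function.update w s(u, x) 0)
    s(x, v) 0) s(u, v) 0) f 0) q ∅ ω * ind (openConn u v : Set (BondConfig V)) ω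
  set S1 := ∑ ω : BondConfig V, rcWeightW (Function.update (Function.update (Function.update (Function.update w s(u, x) 0)
    s(x, v) 0) s(u, v) 0) f 1) q ∅ ω * ind (openConn u v : Set (BondConfig V)) ω
  set Z0 := rcPartitionFunctionW (Function.update (Function.update (Function.update (Function.update w s(u, x) 0)
    s(x, v) 0) s(u, v) 0) f 0) q ∅
  set Z1 := rcPartitionFunctionW (Function.update (Function.update (Function.update (Function.update w s(u, x) 0)
    s(x, v) 0) s(u, v) 0) f 1) q ∅
  have hp₁0 : 0 ≤ p₁ := (w s(u, x)).2.1
  have hp₁1 : p₁ ≤ 1 := (w s(u, x)).2.2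
  have hp₂0 : 0 ≤ p₂ := (w s(x, v)).2.1
  have hp₂1 : p₂ ≤ 1 := (w s(x, v)).2.2
  have hr0 : 0 ≤ r := inv_nonneg.2 hq0.le
  have hα : 0 ≤ (1 - p₁) * (1 - p₂) + (p₁ + p₂ * (1 - p₁)) * r := by
    have h1 : 0 ≤ 1 - p₁ := by linarith
    have h2 : 0 ≤ 1 - p₂ := by linarith
    positivity
  have hδ : 0 ≤ (1 - p₁) * (1 - p₂) + ((1 - p₁) * p₂ + p₁ * (1 - p₂)) * r := by
    have h1 : 0 ≤ 1 - p₁ := by linarith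
    have h2 : 0 ≤ 1 - p₂ := by linarith
    positivity
  have hk : 0 ≤ S1 * Z0 - S0 * Z1 := sub_nonneg.2 hEC
  have hid : (((1 - p₁ + p₁ * r) * (1 - p₂ + p₂ * r) - p₁ * p₂ * r * (r - 1)) * S1 + p₁ * p₂ * (r * r) * (Z1 - S1)) *
        ((1 - p₁ + p₁ * r) * (1 - p₂ + p₂ * r) * Z0 - p₁ * p₂ * r * (r - 1) * S0) -
      (((1 - p₁ + p₁ * r) * (1 - p₂ + p₂ * r) - p₁ * p₂ * r * (r - 1)) * S0 + p₁ * p₂ * (r * r) * (Z0 - S0)) *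
        ((1 - p₁ + p₁ * r) * (1 - p₂ + p₂ * r) * Z1 - p₁ * p₂ * r * (r - 1) * S1) =
      ((1 - p₁) * (1 - p₂) + (p₁ + p₂ * (1 - p₁)) * r) * ((1 - p₁) * (1 - p₂) + ((1 - p₁) * p₂ + p₁ * (1 - p₂)) * r) *
        (S1 * Z0 - S0 * Z1) := by ring
  have hprod := mul_nonneg (mul_nonneg hα hδ) hk
  linarith [hid, hprod]


end FK

end Summit.CriticalPhenomena.PercolationContinuityZ3.Theorems

end
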